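import Literature.NumberTheory.Automorphic.JacquetModuleFrobeniusProofs
import Summits.HodgeConjecture.HodgeConjecture.Theorems.F0P2nBorelCharactersUnipotent
import HarnessLib

/-!
# Frobenius reciprocity for the principal series `i_G(χ)` of `U(3)(L⁺_v)`, UNCONDITIONAL

Cell hodgecm-mathlib F0∕P2, crux `stmt-HodgeConjecture-24833` (`H413`), line `Cruxes/H413/Lines/F0_P2GR91NJacquet.lean`.
★ `Representation.frobenius_normalizedInd_holds` (`JacquetModuleFrobeniusProofs`: Bernstein–Zelevinsky 1977 Prop. 1.9 (b),
`Hom_G(π, i_P^G σ) ≃ₗ[ℂ] Hom_M(r_P^G π, σ)` for a parabolic triple whose modulus is trivial on `N`) with its hypothesis `hδ`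
DISCHARGED for the Borel of the quasi-split `U(3)` at a finite place by ★ `F0P2nBorelCharactersUnipotent.deltaChar_cmBorel_eq_one`
(every character of `B(L⁺_v)` kills `N(L⁺_v)`).  Kept in its own module because `JacquetModuleFrobeniusProofs` is outside the
cone of ★ `F0P2nBorelCharactersUnipotent`.

References: [BernsteinZelevinsky1977, Prop. 1.9 (b), §2.3]; [Rogawski1990, §12.1–§12.2].
-/

set_option autoImplicit false
set_option linter.dupNamespace false

noncomputable section

open NumberField IsDedekindDomain

namespace Summit.HodgeConjecture.HodgeConjecture.Cruxes.H413.F0P2nFrobeniusCmPrincipalSeries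

open Literature.NumberTheory.Automorphic Literature.NumberTheory.Automorphic.UnitaryGroup

variable (L : Type) [Field L] [NumberField L] [IsCMField L]

set_option synthInstance.maxHeartbeats 400000 in
set_option maxHeartbeats 8000000 in
/-- **Frobenius reciprocity for the principal series of `U(3)(L⁺_v)`** (unconditional): for a smooth representation `π` of
`U(Φ₃)(L⁺_v)` and a character `χ` of the diagonal torus `T(L⁺_v)`,
`Hom_G(π, i_G(χ)) ≃ₗ[ℂ] Hom_T(r_B^G π, χ)` with `i_G(χ)` = ★ `cmPrincipalSeries L 3 v χ` and `r_B^G` = ★ `Representation.normalizedJacquet`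
(★ `frobenius_normalizedInd_holds` at ★ `deltaChar_cmBorel_eq_one`). [cite: BernsteinZelevinsky1977, Prop. 1.9 (b)] [cite: Rogawski1990, §12.1 p. 171] -/
theorem frobenius_cmPrincipalSeries (v : HeightOneSpectrum (𝓞 ↥(maximalRealSubfield L)))
    (χ : ↥(torusU (conjLocal L (IsCMField.complexConj L) v) (cmLocalForm L 3 v)) →* ℂˣ)
    {V : Type*} [AddCommGroup V] [Module ℂ V]
    (π : Representation ℂ ↥(unitaryGroupOfForm (conjLocal L (IsCMField.complexConj L) v) (cmLocalForm L 3 v)) V)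
    (hπ : π.IsSmooth) :
    haveI := locallyCompactSpace_cmBorelU L 3 v
    Nonempty (π.IntertwiningMap (cmPrincipalSeries L 3 v χ) ≃ₗ[ℂ]
      (π.normalizedJacquet (cmBorelTriple L 3 v)).IntertwiningMap
        ((Representation.trivial ℂ ↥(torusU (conjLocal L (IsCMField.complexConj L) v) (cmLocalForm L 3 v)) ℂ).twist χ)) :=
  haveI := locallyCompactSpace_cmBorelU L 3 v
  show Nonempty (π.IntertwiningMap (Representation.normalizedInd (cmBorelTriple L 3 v)
      ((Representation.trivial ℂ ↥(torusU (conjLocal L (IsCMField.complexConj L) v) (cmLocalForm L 3 v)) ℂ).twist χ)) ≃ₗ[ℂ] _) from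
    Representation.frobenius_normalizedInd_holds (cmBorelTriple L 3 v) (F0P2nBorelCharactersUnipotent.deltaChar_cmBorel_eq_one L v) π
      ((Representation.trivial ℂ ↥(torusU (conjLocal L (IsCMField.complexConj L) v) (cmLocalForm L 3 v)) ℂ).twist χ) hπ

set_option synthInstance.maxHeartbeats 400000 in
set_option maxHeartbeats 8000000 in
/-- The same over the letter's carrier ★ `Rogawski1990.Gqs L v` and character `χ_ξ` = ★ `cmXiTorusChar L v μ η₁ η₂`.
[cite: BernsteinZelevinsky1977, Prop. 1.9 (b)] [cite: Rogawski1990, §12.2 p. 174] -/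
theorem frobenius_cmPrincipalSeries_xi (v : HeightOneSpectrum (𝓞 ↥(maximalRealSubfield L)))
    (μ : (LocalRing L v)ˣ →* ℂˣ) (η₁ η₂ : ↥(normOneUnits (conjLocal L (IsCMField.complexConj L) v)) →* ℂˣ)
    {V : Type*} [AddCommGroup V] [Module ℂ V] (π : Representation ℂ (Literature.NumberTheory.Rogawski1990.Gqs L v) V)
    (hπ : π.IsSmooth) :
    haveI := locallyCompactSpace_cmBorelU L 3 v
    Nonempty (π.IntertwiningMap (cmPrincipalSeries L 3 v (cmXiTorusChar L v μ η₁ η₂)) ≃ₗ[ℂ]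
      (π.normalizedJacquet (cmBorelTriple L 3 v)).IntertwiningMap
        ((Representation.trivial ℂ ↥(torusU (conjLocal L (IsCMField.complexConj L) v) (cmLocalForm L 3 v)) ℂ).twist
          (cmXiTorusChar L v μ η₁ η₂))) :=
  frobenius_cmPrincipalSeries L v (cmXiTorusChar L v μ η₁ η₂) π hπ

end Summit.HodgeConjecture.HodgeConjecture.Cruxes.H413.F0P2nFrobeniusCmPrincipalSeries

end
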